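import Mathlib
import Summits.Ventures.HodgeRepro2.T6N5Skeleton
import Summits.Ventures.HodgeRepro2.T6N5LocalDatum
import Summits.Ventures.HodgeRepro2.T6N5Local
import Summits.Ventures.HodgeRepro2.T6N5LocalSides

/-!
# T6N5LocalSidesPlaces — Tier 6, M2 sub-step N5 (t6-p8's half): condition (b) of a toric side BY KINDS OF PLACE

`T6N5LocalSides.condB_of_localSolution_A` / `_B` give t6-p7's `ToricSide.condB` for a side whose sign fields agree
with local solutions of the coupled system at EVERY index `v : ι`. The per-place theorems of this lane
(`N5Local_main_inert_completion'`, `N5Local_main_ram_completion_all'`, …) exist at the finite places of `F`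
non-split in `E` only; at the SPLIT places both signs are `1` by definition (TIER5 §N5.5: `ε_{E_v/F_v}(ξ_i, ψ_v, δ) := 1`
at a split place — Borade's tuple, `[Bo-eps-tuple]` l. 6 — and `ω_{E_v/F_v}(λ_i) = 1` since `ω_{E_v/F_v}` is the
trivial character of a split quadratic algebra), and at the REAL places condition (b) is the route's residual
(MEMO §10.4(C) via Rem. 5.5 — the S–E weights; class IR on the M2 line, t6-p7's census §12).

This file states that accounting as a theorem: the index type is covered by three sets `NS` (finite non-split),
`Sp` (split) and `R` (real); condition (b) on the side follows from local solutions on `NS`, the definitional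
values on `Sp`, and condition (b) on `R` alone — so the ONLY residual hypothesis of `condB` is its restriction to
the real places (`hR`). Both patterns (side A: lines `a, b`; side B: lines `c, d` with the `η_v(u)` twist) are given,
plus the `∃`-form that the per-place theorems deliver.
README §8(d): uses an L-value-free non-vanishing device: NO.
-/

namespace Summit.Ventures.HodgeRepro2.T6.N5LocalSidesPlaces

open Summit.Ventures.HodgeRepro2.T6.N5LocalDatum Summit.Ventures.HodgeRepro2.T6.N5Skeleton
  Summit.Ventures.HodgeRepro2.T6.N5Local

variable {ι G : Type*} [CommGroup G]

/-- Condition (b) from its restrictions to a covering family of sets of places. -/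
theorem condB_of_cover (X : ToricSide ι G) (NS Sp R : Set ι) (hcover : ∀ v, v ∈ NS ∨ v ∈ Sp ∨ v ∈ R)
    (hNS : ∀ v ∈ NS, ∀ i : Fin 2, X.omega v i = X.eps v i)
    (hSp : ∀ v ∈ Sp, ∀ i : Fin 2, X.omega v i = X.eps v i)
    (hR : ∀ v ∈ R, ∀ i : Fin 2, X.omega v i = X.eps v i) : X.condB := by
  intro v i
  rcases hcover v with h | h | h
  · exact hNS v h i
  · exact hSp v h i
  · exact hR v h i

/-- At a split place both signs are `1` by definition (`ε := 1`, `ω_{E_v/F_v} = 1`), so (b) holds there. -/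
theorem condB_at_of_eq_one (X : ToricSide ι G) {v : ι} (hω : ∀ i : Fin 2, X.omega v i = 1)
    (hε : ∀ i : Fin 2, X.eps v i = 1) : ∀ i : Fin 2, X.omega v i = X.eps v i := by
  intro i
  rw [hω, hε]

/-- Condition (b) for a side with side A's pattern at the finite non-split places (`omega v i = ω_{E_v/F_v}(λ_i)`,
`eps v i = ε_v(ξ_{i,v})`, lines `a = 0`, `b = 1`), the definitional values at the split places, and (b) at the real
places: the residual is `hR` alone. -/
theorem condB_of_places_A (X : ToricSide ι G) (NS Sp R : Set ι) (hcover : ∀ v, v ∈ NS ∨ v ∈ Sp ∨ v ∈ R)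
    (D : ι → LocalSignDatum) (ξ : ∀ v, Fin 4 → (D v).Char)
    (hξ : ∀ v ∈ NS, LocalSolution (D v) (ξ v))
    (hω : ∀ v ∈ NS, ∀ i : Fin 2, X.omega v i = (D v).ηLine i)
    (hε : ∀ v ∈ NS, ∀ i : Fin 2, X.eps v i = (D v).eps (ξ v (Fin.castLE (by decide) i)))
    (hSpω : ∀ v ∈ Sp, ∀ i : Fin 2, X.omega v i = 1) (hSpε : ∀ v ∈ Sp, ∀ i : Fin 2, X.eps v i = 1)
    (hR : ∀ v ∈ R, ∀ i : Fin 2, X.omega v i = X.eps v i) : X.condB := by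
  refine condB_of_cover X NS Sp R hcover ?_ (fun v hv => condB_at_of_eq_one X (hSpω v hv) (hSpε v hv)) hR
  intro v hv i
  rw [hω v hv, hε v hv]
  obtain ⟨-, h0, h1, -, -, -⟩ := hξ v hv
  fin_cases i
  · exact h0.symm
  · exact h1.symm

/-- The same with side B's pattern at the finite non-split places (`omega v i = η_v(u)·ω_{E_v/F_v}(λ_i)`,
`eps v i = ε_v(ξ_{i+2,v})`, lines `c = 2`, `d = 3`). -/
theorem condB_of_places_B (X : ToricSide ι G) (NS Sp R : Set ι) (hcover : ∀ v, v ∈ NS ∨ v ∈ Sp ∨ v ∈ R)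
    (D : ι → LocalSignDatum) (ξ : ∀ v, Fin 4 → (D v).Char)
    (hξ : ∀ v ∈ NS, LocalSolution (D v) (ξ v))
    (hω : ∀ v ∈ NS, ∀ i : Fin 2, X.omega v i = (D v).ηu * (D v).ηLine i)
    (hε : ∀ v ∈ NS, ∀ i : Fin 2, X.eps v i = (D v).eps (ξ v (i.addNat 2)))
    (hSpω : ∀ v ∈ Sp, ∀ i : Fin 2, X.omega v i = 1) (hSpε : ∀ v ∈ Sp, ∀ i : Fin 2, X.eps v i = 1)
    (hR : ∀ v ∈ R, ∀ i : Fin 2, X.omega v i = X.eps v i) : X.condB := by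
  refine condB_of_cover X NS Sp R hcover ?_ (fun v hv => condB_at_of_eq_one X (hSpω v hv) (hSpε v hv)) hR
  intro v hv i
  rw [hω v hv, hε v hv]
  obtain ⟨-, -, -, h2, h3, -⟩ := hξ v hv
  fin_cases i
  · exact h2.symm
  · exact h3.symm

/-- Local solutions on `NS` from place-by-place solvability there (the shape the per-place theorems deliver),
extended by an arbitrary quadruple elsewhere. -/
theorem exists_family_of_forall_mem_exists (NS : Set ι) (D : ι → LocalSignDatum)
    (h : ∀ v ∈ NS, ∃ ξ : Fin 4 → (D v).Char, LocalSolution (D v) ξ) :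
    ∃ ξ : ∀ v, Fin 4 → (D v).Char, ∀ v ∈ NS, LocalSolution (D v) (ξ v) := by
  classical
  refine ⟨fun v => if hv : v ∈ NS then (h v hv).choose else fun _ => 1, fun v hv => ?_⟩
  simp only [hv, dite_true]
  exact (h v hv).choose_spec

/-- Condition (b) on BOTH sides (side A's and side B's patterns on `XA` / `XB`) and the (S–H) identity
`ξ_c ξ_d = ξ_a ξ_b` at every finite non-split place, from: solvability of the coupled system at every `v ∈ NS`,
the definitional values at the split places, and (b) at the real places — the `∃`-form for the M2 assembly. -/
theorem condB_of_places (XA XB : ToricSide ι G) (NS Sp R : Set ι) (hcover : ∀ v, v ∈ NS ∨ v ∈ Sp ∨ v ∈ R)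
    (D : ι → LocalSignDatum)
    (h : ∀ v ∈ NS, ∃ ξ : Fin 4 → (D v).Char, LocalSolution (D v) ξ)
    (hωA : ∀ v ∈ NS, ∀ i : Fin 2, XA.omega v i = (D v).ηLine i)
    (hωB : ∀ v ∈ NS, ∀ i : Fin 2, XB.omega v i = (D v).ηu * (D v).ηLine i)
    (hSpωA : ∀ v ∈ Sp, ∀ i : Fin 2, XA.omega v i = 1) (hSpεA : ∀ v ∈ Sp, ∀ i : Fin 2, XA.eps v i = 1)
    (hSpωB : ∀ v ∈ Sp, ∀ i : Fin 2, XB.omega v i = 1) (hSpεB : ∀ v ∈ Sp, ∀ i : Fin 2, XB.eps v i = 1)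
    (hRA : ∀ v ∈ R, ∀ i : Fin 2, XA.omega v i = XA.eps v i)
    (hRB : ∀ v ∈ R, ∀ i : Fin 2, XB.omega v i = XB.eps v i) :
    ∃ ξ : ∀ v, Fin 4 → (D v).Char,
      ((∀ v ∈ NS, ∀ i : Fin 2, XA.eps v i = (D v).eps (ξ v (Fin.castLE (by decide) i))) → XA.condB) ∧
      ((∀ v ∈ NS, ∀ i : Fin 2, XB.eps v i = (D v).eps (ξ v (i.addNat 2))) → XB.condB) ∧
      ∀ v ∈ NS, ξ v 2 * ξ v 3 = ξ v 0 * ξ v 1 := by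
  obtain ⟨ξ, hξ⟩ := exists_family_of_forall_mem_exists NS D h
  refine ⟨ξ, fun hεA => condB_of_places_A XA NS Sp R hcover D ξ hξ hωA hεA hSpωA hSpεA hRA,
    fun hεB => condB_of_places_B XB NS Sp R hcover D ξ hξ hωB hεB hSpωB hSpεB hRB, fun v hv => ?_⟩
  obtain ⟨-, -, -, -, -, hSH⟩ := hξ v hv
  exact hSH

end Summit.Ventures.HodgeRepro2.T6.N5LocalSidesPlaces
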